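/-
Copyright (c) 2026 the pub-hodgecm-mathlib formalisation cell (harness21).  Prover seat hodgecm-mathlib-LH10-p01 (g12): road M6 → F5 → dyadic chain of `stub_DyUnramCore` (D-UNR),
brick (U)-dy «THE FINITE-GROUP ROOT, 2-FREE» part 3∕3 — ORGAN (U) «STRATA CONSTANCY» at EVERY unramified non-split place, dyadic included; 2026-09-03.
-/
import Literature.NumberTheory.Rogawski1990.LevelOnePieceStrataConstancy                  -- ★ (F0P3a-p06) ORGAN (U) with `h2` (the `v ∤ 2` original) and its whole import kit (Hensel surjectivity, reduction, ROW-0 bridge)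
import Literature.GroupTheory.SpecificGroups.FiniteUnitaryThreeUnipotentJordanClassesAnyChar -- ★-to-be (this seat, part 2∕3): `exists_conj_eq_of_rank_sub_one_eq_of_hermitian_anyChar` (no `(2 : k) ≠ 0`)
import HarnessLib

/-!
# ORGAN (U) «STRATA CONSTANCY» in EVERY residue characteristic: a level-1 `K`-class piece on `U(H′)(L⁺_v)` is constant on each residually-unipotent Jordan stratum
# — `v` non-split and unramified in `L`, dyadic `v ∣ 2` INCLUDED

Topic `NumberTheory/Rogawski1990`; namespace `Literature.NumberTheory.Rogawski1990`.  THEOREMS ONLY (no definition, no instance, no notation, no named fact, no `sorry`);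
kernel lane `--supports stmt-HodgeConjecture-24833`.  Cell `pub/hodgecm-mathlib` (D-0151), crux H413 = `stmt-HodgeConjecture-24833`; road M6 → F5 → the DYADIC CHAIN of organ (D-UNR)
`stub_DyUnramCore` (`Cruxes/H413/Lines/F0_P3c_DyadicPaydown.lean` :103; SIG-F5 v2 §0 (4)): the level-one step ★ (U) `strataConstancy_of_levelOne`
(`LevelOnePieceStrataConstancy` :246) of ★ `localTransferAtOne_of_hyperspecialLevel_le_one` carries `h2 : IsUnit (2 : 𝒪_w)` and uses it ONLY as `(2 : 𝓀_w) ≠ 0` for the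
finite-group fact ★ `exists_conj_eq_of_rank_sub_one_eq_of_hermitian … h2k` (Jordan rank classifies the unipotent classes of `U₃(𝔽_q)`, `q` odd).  Part 2∕3
(`FiniteUnitaryThreeUnipotentJordanClassesAnyChar`) proves that fact for EVERY `q` (Prop. 3.9.1 under `∃ θ, θ + σθ = 1`, part 1∕3; the trace `𝔽_{q²} → 𝔽_q` is onto), so the
organ holds with `h2` DELETED: this file is ★ (U) VERBATIM — statement tokens, proof, Hensel surjectivity `K ↠ U(σ̄_w, H̄′_w)(𝓀_w)`, the ROW-0 bridge — with the binder
`h2` and the line `h2k` removed and the finite-group call re-sourced to `…_of_hermitian_anyChar`.  A dyadic twin of ★ `localTransferAtOne_of_hyperspecialLevel_le_one` calls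
`strataConstancy_of_levelOne_anyChar` with the ★ argument list minus `h2`.
HONEST LABEL: HC_CM is proved only modulo the 7 printed citations (2 remaining named inputs: hLiu418 = stmt-HodgeConjecture-24832, h413 = stmt-HodgeConjecture-24833) until rung 0
closes; unconditional local algebra, count-neutral (zero label movement until the desk prices the `stub_N6nsDyadic` rider); asserts nothing printed about the transfer.

THE MATHEMATICS ([Rogawski1990, §4.9 p. 54; §3.9 p. 32, Prop. 3.9.1]) is ★ (U)'s: reduction `K → U(σ̄_w, H̄′_w)(𝓀_w)` is a surjective homomorphism (Hensel ∕ Kottwitz Lemma 7.2,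
any residue characteristic); two residual unipotents of equal Jordan rank are conjugate in the finite unitary group (NOW for every `q`); lift the conjugator, and the
quotient `u = k′·(yky⁻¹)⁻¹` reduces to `1`, i.e. `u_w ≡ 1 (ϖ)`, so `g k′ = g (yky⁻¹) = g k`.

* `apply_eq_apply_of_rank_redMat_sub_one_eq_anyChar` — `g k = g k′` for residually unipotent `k, k′ ∈ K` of equal Jordan rank (no `h2`);
* **`strataConstancy_of_levelOne_anyChar`** — THE ORGAN without `h2`: `∃ c : ℕ → ℂ, ∀ k ∈ K, (red k_w − 1)³ = 0 → g k = c (rank (red k_w − 1))`.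

## References
* [Rogawski1990] J. D. Rogawski, *Automorphic Representations of Unitary Groups in Three Variables*, Ann. of Math. Stud. 123 (1990): §4.9 p. 54 (the pieces on the
  hyperspecial `K`), §3.9 p. 32 and Prop. 3.9.1 (unipotent classes of `U(3)`).
* [PlatonovRapinchuk1994] V. Platonov, A. Rapinchuk, *Algebraic Groups and Number Theory* (1994): §3.3 (reduction `G_𝒪 → G_𝓀`, Hensel), §5.1.
* [Wilson2009] R. A. Wilson, *The Finite Simple Groups*, GTM 251 (2009): §3.6.1 p. 67 (unipotent classes of `GU₃(q)`, every `q`).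
-/

set_option autoImplicit false

noncomputable section

open NumberField IsDedekindDomain Matrix ValuativeRel
open Literature.NumberTheory.Automorphic Literature.NumberTheory.GaloisRepresentations Literature.NumberTheory.Automorphic.UnitaryGroup
open Literature.NumberTheory.Automorphic.IntegralReduction Literature.GroupTheory.SpecificGroups
open scoped Matrix MatrixGroups ValuativeRel

namespace Literature.NumberTheory.Rogawski1990

section OrganU

set_option maxHeartbeats 800000 in
-- budget only: one statement-heavy declaration (the CM-place tokens of the END's stub); no search tactic runs long here.
/-- **(U), pairwise form, EVERY residue characteristic: a level-1 `K`-class piece takes EQUAL values at residually-unipotent `k, k′ ∈ K` of EQUAL Jordan rank** `rank(red k_w − 1) = rank(red k′_w − 1)`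
(`(red k_w − 1)³ = 0`, `(red k′_w − 1)³ = 0`): Hensel surjectivity `K ↠ U(σ̄_w, H̄′_w)(𝓀_w)` (★ `unitary_residueHom_surjective_of_frobenius`) lifts the finite-group
conjugator of part 2∕3 `exists_conj_eq_of_rank_sub_one_eq_of_hermitian_anyChar` (no `(2 : 𝓀_w) ≠ 0`) to `y ∈ K`; then `k′ = u·(yky⁻¹)` with `u_w ≡ 1 (ϖ)` and
`g k′ = g (yky⁻¹) = g k`.  ★ `apply_eq_apply_of_rank_redMat_sub_one_eq` VERBATIM minus `h2`. [cite: Rogawski1990, §4.9 p. 54; §3.9 p. 32, Prop. 3.9.1] [cite: PlatonovRapinchuk1994, §3.3] -/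
theorem apply_eq_apply_of_rank_redMat_sub_one_eq_anyChar
    (L : Type) [Field L] [NumberField L] [IsCMField L] (H' : Matrix (Fin 3) (Fin 3) L)
    {v : HeightOneSpectrum (𝓞 ↥(maximalRealSubfield L))}
    (hH' : (H'.map (cmConjRingHom L)).transpose = H') (w : PlacesOver L v)
    (hw : IsCMField.complexConj L • w.1 = w.1) (hv : Algebra.IsUnramifiedIn (𝓞 L) v.asIdeal)
    (hH'w : IsUnit (placeForm H' w.1)) (hH'i : hH'w.unit ∈ glInt 3 (w.1.adicCompletion L))
    (g : ((cmDatum L 3 H').Local v) → ℂ)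
    (hginv : ∀ u ∈ (cmLocalIntegralLevel L 3 H' v), ∀ x, g (u * x * u⁻¹) = g x)
    (hg1 : ∀ u : ((cmDatum L 3 H').Local v),
      (∀ a b, Valued.v ((((toPlace v w (HeckeCharacter.uniformizer ↥(maximalRealSubfield L) v : v.adicCompletion ↥(maximalRealSubfield L)))) ^ 1)⁻¹ *
        (((((localNonsplitEquiv (IsCMField.complexConj L) H' (IsCMField.complexConj_ne_one L) w hw u) : ↥(unitaryGroupOfForm (galAdicCompletionMap (L := L) (IsCMField.complexConj L) hw) (placeForm H' w.1))) : GL (Fin 3) (w.1.adicCompletion L)) : Matrix (Fin 3) (Fin 3) (w.1.adicCompletion L)) a b - (1 : Matrix (Fin 3) (Fin 3) (w.1.adicCompletion L)) a b)) ≤ 1) →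
      ∀ x, g (u * x) = g x)
    {k k' : ((cmDatum L 3 H').Local v)} (hk : k ∈ (cmLocalIntegralLevel L 3 H' v)) (hk' : k' ∈ (cmLocalIntegralLevel L 3 H' v))
    (hnil : (redMat (((k).val : GL (Fin 3) (UnitaryGroup.LocalRing L v)).val.map (Pi.evalRingHom (fun w' : PlacesOver L v => w'.1.adicCompletion L) w)) - 1) ^ 3 = 0) (hnil' : (redMat (((k').val : GL (Fin 3) (UnitaryGroup.LocalRing L v)).val.map (Pi.evalRingHom (fun w' : PlacesOver L v => w'.1.adicCompletion L) w)) - 1) ^ 3 = 0)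
    (hrank : (redMat (((k).val : GL (Fin 3) (UnitaryGroup.LocalRing L v)).val.map (Pi.evalRingHom (fun w' : PlacesOver L v => w'.1.adicCompletion L) w)) - 1).rank = (redMat (((k').val : GL (Fin 3) (UnitaryGroup.LocalRing L v)).val.map (Pi.evalRingHom (fun w' : PlacesOver L v => w'.1.adicCompletion L) w)) - 1).rank) :
    g k = g k' := by
  classical
  have hc1 : IsCMField.complexConj L ≠ 1 := IsCMField.complexConj_ne_one L
  -- §0 the place `w`: involution `σ_w`, its integral ∕ residual avatars, Frobenius, `|𝓀_w| = q²`, the `σ`-fixed uniformizer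
  have hσO : ∀ x : 𝒪[(w.1.adicCompletion L)], (galAdicCompletionMap (L := L) (IsCMField.complexConj L) hw) x ∈ 𝒪[(w.1.adicCompletion L)] := mem_integer_galAdicCompletionMap (IsCMField.complexConj L) v w hw
  have hσσ : ∀ x, (galAdicCompletionMap (L := L) (IsCMField.complexConj L) hw) ((galAdicCompletionMap (L := L) (IsCMField.complexConj L) hw) x) = x := fun x => galAdicCompletionMap_galAdicCompletionMap_of_smul_eq (IsCMField.complexConj L) w hc1 hw x
  obtain ⟨σk, hσk⟩ := exists_residueField_ringHom_galAdicCompletionMap (IsCMField.complexConj L) v w hw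
  have hq : Nat.card 𝓀[(w.1.adicCompletion L)] = Nat.card (𝓞 ↥(maximalRealSubfield L) ⧸ v.asIdeal) ^ 2 := natCard_residueField_eq_sq_of_inert (IsCMField.complexConj L) v hc1 hv w hw
  have hσq : ∀ y : 𝓀[(w.1.adicCompletion L)], σk y = y ^ Nat.card (𝓞 ↥(maximalRealSubfield L) ⧸ v.asIdeal) :=
    residueHom_galAdicCompletionMap_eq_pow (IsCMField.complexConj L) v hc1 hv w hw σk hσO hσk
  letI : Fintype 𝓀[(w.1.adicCompletion L)] := Fintype.ofFinite _
  have hq' : Fintype.card 𝓀[(w.1.adicCompletion L)] = Nat.card (𝓞 ↥(maximalRealSubfield L) ⧸ v.asIdeal) ^ 2 := by rw [← Nat.card_eq_fintype_card, hq]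
  have hϖv := Liu2021.LemD1IndexedNonVacuityInertCofinite.valued_toPlace_uniformizer_of_isUnramifiedIn L v hv w
  have hϖ : IsUniformizingElement (toPlace v w (HeckeCharacter.uniformizer ↥(maximalRealSubfield L) v : v.adicCompletion ↥(maximalRealSubfield L))) := isUniformizingElement_of_v_eq hϖv
  have hσϖ : (galAdicCompletionMap (L := L) (IsCMField.complexConj L) hw) (toPlace v w (HeckeCharacter.uniformizer ↥(maximalRealSubfield L) v : v.adicCompletion ↥(maximalRealSubfield L))) = (toPlace v w (HeckeCharacter.uniformizer ↥(maximalRealSubfield L) v : v.adicCompletion ↥(maximalRealSubfield L))) := galAdicCompletionMap_toPlace (IsCMField.complexConj L) w w hw _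
  -- §1 the form `J = H′_w` and its integral model `J_𝒪` (unimodular, `σ_w`-hermitian)
  have hJint : ∀ i j, (placeForm H' w.1) i j ∈ 𝒪[(w.1.adicCompletion L)] := fun i j => ((mem_glInt_iff _).1 hH'i).1 i j
  have hJinv : ∀ i j, (((hH'w.unit⁻¹ : (Matrix (Fin 3) (Fin 3) (w.1.adicCompletion L))ˣ) : Matrix (Fin 3) (Fin 3) (w.1.adicCompletion L))) i j ∈ 𝒪[(w.1.adicCompletion L)] :=
    fun i j => ((mem_glInt_iff _).1 hH'i).2 i j
  let JO : Matrix (Fin 3) (Fin 3) 𝒪[(w.1.adicCompletion L)] := Matrix.of fun i j => ⟨(placeForm H' w.1) i j, hJint i j⟩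
  have hJ : (placeForm H' w.1) = JO.map ((↑) : 𝒪[(w.1.adicCompletion L)] → (w.1.adicCompletion L)) := by ext i j; rfl
  have hinjO : Function.Injective (fun M : Matrix (Fin 3) (Fin 3) 𝒪[(w.1.adicCompletion L)] => M.map ((↑) : 𝒪[(w.1.adicCompletion L)] → (w.1.adicCompletion L))) :=
    Matrix.map_injective Subtype.val_injective
  have hJOdet : IsUnit JO.det := by
    let JI : Matrix (Fin 3) (Fin 3) 𝒪[(w.1.adicCompletion L)] :=
      Matrix.of fun i j => ⟨(((hH'w.unit⁻¹ : (Matrix (Fin 3) (Fin 3) (w.1.adicCompletion L))ˣ) : Matrix (Fin 3) (Fin 3) (w.1.adicCompletion L))) i j, hJinv i j⟩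
    have hJI : (((hH'w.unit⁻¹ : (Matrix (Fin 3) (Fin 3) (w.1.adicCompletion L))ˣ) : Matrix (Fin 3) (Fin 3) (w.1.adicCompletion L))) = JI.map ((↑) : 𝒪[(w.1.adicCompletion L)] → (w.1.adicCompletion L)) := by
      ext i j; rfl
    have hmul : JO * JI = 1 := by
      apply hinjO
      change (JO * JI).map ⇑(𝒪[(w.1.adicCompletion L)]).subtype = (1 : Matrix (Fin 3) (Fin 3) 𝒪[(w.1.adicCompletion L)]).map ⇑(𝒪[(w.1.adicCompletion L)]).subtype
      rw [Matrix.map_mul, Matrix.map_one (𝒪[(w.1.adicCompletion L)]).subtype (map_zero _) (map_one _)]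
      change JO.map ((↑) : 𝒪[(w.1.adicCompletion L)] → (w.1.adicCompletion L)) * JI.map ((↑) : 𝒪[(w.1.adicCompletion L)] → (w.1.adicCompletion L)) = 1
      rw [← hJ, ← hJI]
      have hmi := hH'w.unit.mul_inv
      rw [hH'w.unit_spec] at hmi
      exact hmi
    exact Matrix.isUnit_det_of_right_inverse hmul
  have hJσ : ((placeForm H' w.1).map (galAdicCompletionMap (L := L) (IsCMField.complexConj L) hw))ᵀ = (placeForm H' w.1) := placeForm_hermitian_of_smul_eq (c := IsCMField.complexConj L) w H' hH' hw
  clear_value JO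
  -- §2 reduction `red : K_w → U(σ̄_w, J̄)(𝓀_w)` (★ D-T1u) and its SURJECTIVITY (★ Hensel)
  obtain ⟨red, hred⟩ := exists_unitary_residueHom (galAdicCompletionMap (L := L) (IsCMField.complexConj L) hw) (placeForm H' w.1) JO hJ σk hσO hσk
  have hsurj : Function.Surjective red :=
    unitary_residueHom_surjective_of_frobenius (galAdicCompletionMap (L := L) (IsCMField.complexConj L) hw) (placeForm H' w.1) hσσ hσO σk hσk hq hσq JO hJ hJσ hJOdet
      ⟨_, hϖ.mem⟩ hϖ.span_eq hσϖ red hred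
  -- the residual form `J̄ = J_𝒪 mod 𝓂` is `σ̄`-hermitian and non-degenerate
  let τ : 𝒪[(w.1.adicCompletion L)] → 𝒪[(w.1.adicCompletion L)] := fun x => ⟨(galAdicCompletionMap (L := L) (IsCMField.complexConj L) hw) x, hσO x⟩
  have hJOτ : (JO.map τ)ᵀ = JO := by
    apply hinjO
    change ((JO.map τ)ᵀ).map ((↑) : 𝒪[(w.1.adicCompletion L)] → (w.1.adicCompletion L)) = JO.map ((↑) : 𝒪[(w.1.adicCompletion L)] → (w.1.adicCompletion L))
    rw [Matrix.transpose_map]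
    have hmm : (JO.map τ).map ((↑) : 𝒪[(w.1.adicCompletion L)] → (w.1.adicCompletion L)) = (JO.map ((↑) : 𝒪[(w.1.adicCompletion L)] → (w.1.adicCompletion L))).map (galAdicCompletionMap (L := L) (IsCMField.complexConj L) hw) := by ext i j; rfl
    rw [hmm, ← hJ]
    exact hJσ
  have hJk : ((JO.map (IsLocalRing.residue 𝒪[(w.1.adicCompletion L)])).map σk)ᵀ = JO.map (IsLocalRing.residue 𝒪[(w.1.adicCompletion L)]) := by
    have h := congrArg (fun M : Matrix (Fin 3) (Fin 3) 𝒪[(w.1.adicCompletion L)] => M.map (IsLocalRing.residue 𝒪[(w.1.adicCompletion L)])) hJOτ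
    simp only [Matrix.transpose_map, Matrix.map_map] at h
    have hcomp : (⇑(IsLocalRing.residue 𝒪[(w.1.adicCompletion L)]) ∘ τ) = (⇑σk ∘ ⇑(IsLocalRing.residue 𝒪[(w.1.adicCompletion L)])) := funext fun x => hσk x
    rw [hcomp, ← Matrix.map_map] at h
    exact h
  have hJkdet : (JO.map (IsLocalRing.residue 𝒪[(w.1.adicCompletion L)])).det ≠ 0 := by
    rw [← RingHom.mapMatrix_apply, ← RingHom.map_det]
    exact (hJOdet.map _).ne_zero
  -- §3 `K` inside the domain `U(J)(𝒪_w)` of `red`; the reduction read on it (entries = residues = `redMat`)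
  have hKI : ∀ {x : ((cmDatum L 3 H').Local v)}, x ∈ (cmLocalIntegralLevel L 3 H' v) → (((localNonsplitEquiv (IsCMField.complexConj L) H' (IsCMField.complexConj_ne_one L) w hw x) : ↥(unitaryGroupOfForm (galAdicCompletionMap (L := L) (IsCMField.complexConj L) hw) (placeForm H' w.1))) : GL (Fin 3) (w.1.adicCompletion L)) ∈ glInt 3 (w.1.adicCompletion L) := fun {x} hx =>
    (mem_localIntegralLevel_iff_of_smul_eq (IsCMField.complexConj L) 3 H' hc1 w hw x).1 hx
  have hredK : ∀ z : ↥((glInt 3 (w.1.adicCompletion L)).subgroupOf (unitaryGroupOfForm (galAdicCompletionMap (L := L) (IsCMField.complexConj L) hw) (placeForm H' w.1))), (((red z : ↥(unitaryGroupOfForm σk (JO.map (IsLocalRing.residue 𝒪[(w.1.adicCompletion L)])))) : GL (Fin 3) 𝓀[(w.1.adicCompletion L)]) : Matrix (Fin 3) (Fin 3) 𝓀[(w.1.adicCompletion L)]) = redMat ((((z : ↥((glInt 3 (w.1.adicCompletion L)).subgroupOf (unitaryGroupOfForm (galAdicCompletionMap (L := L) (IsCMField.complexConj L) hw) (placeForm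 H' w.1)))) : ↥(unitaryGroupOfForm (galAdicCompletionMap (L := L) (IsCMField.complexConj L) hw) (placeForm H' w.1))) : GL (Fin 3) (w.1.adicCompletion L)) : Matrix (Fin 3) (Fin 3) (w.1.adicCompletion L)) := by
    intro z
    ext i j
    rw [hred]
    exact (red_coe _).symm
  -- opaque names for the images of `k, k′` (keeps every later rewrite syntactic)
  obtain ⟨xk, hxk⟩ : ∃ z : ↥((glInt 3 (w.1.adicCompletion L)).subgroupOf (unitaryGroupOfForm (galAdicCompletionMap (L := L) (IsCMField.complexConj L) hw) (placeForm H' w.1))), (z : ↥(unitaryGroupOfForm (galAdicCompletionMap (L := L) (IsCMField.complexConj L) hw) (placeForm H' w.1))) = (localNonsplitEquiv (IsCMField.complexConj L) H' (IsCMField.complexConj_ne_one L) w hw k) := ⟨⟨(localNonsplitEquiv (IsCMField.complexConj L) H' (IsCMField.complexConj_ne_one L) w hw k), hKI hk⟩, rfl⟩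
  obtain ⟨xk', hxk'⟩ : ∃ z : ↥((glInt 3 (w.1.adicCompletion L)).subgroupOf (unitaryGroupOfForm (galAdicCompletionMap (L := L) (IsCMField.complexConj L) hw) (placeForm H' w.1))), (z : ↥(unitaryGroupOfForm (galAdicCompletionMap (L := L) (IsCMField.complexConj L) hw) (placeForm H' w.1))) = (localNonsplitEquiv (IsCMField.complexConj L) H' (IsCMField.complexConj_ne_one L) w hw k') := ⟨⟨(localNonsplitEquiv (IsCMField.complexConj L) H' (IsCMField.complexConj_ne_one L) w hw k'), hKI hk'⟩, rfl⟩
  -- the stub's spelling of `k_w` IS the one-place model's matrix (★ `coe_localNonsplitEquiv_apply`, definitional)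
  have hMk : redMat ((((xk : ↥((glInt 3 (w.1.adicCompletion L)).subgroupOf (unitaryGroupOfForm (galAdicCompletionMap (L := L) (IsCMField.complexConj L) hw) (placeForm H' w.1)))) : ↥(unitaryGroupOfForm (galAdicCompletionMap (L := L) (IsCMField.complexConj L) hw) (placeForm H' w.1))) : GL (Fin 3) (w.1.adicCompletion L)) : Matrix (Fin 3) (Fin 3) (w.1.adicCompletion L)) = redMat (((k).val : GL (Fin 3) (UnitaryGroup.LocalRing L v)).val.map (Pi.evalRingHom (fun w' : PlacesOver L v => w'.1.adicCompletion L) w)) := by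
    rw [hxk]
    exact congrArg redMat (coe_localNonsplitEquiv_apply L H' v w hw k)
  have hMk' : redMat ((((xk' : ↥((glInt 3 (w.1.adicCompletion L)).subgroupOf (unitaryGroupOfForm (galAdicCompletionMap (L := L) (IsCMField.complexConj L) hw) (placeForm H' w.1)))) : ↥(unitaryGroupOfForm (galAdicCompletionMap (L := L) (IsCMField.complexConj L) hw) (placeForm H' w.1))) : GL (Fin 3) (w.1.adicCompletion L)) : Matrix (Fin 3) (Fin 3) (w.1.adicCompletion L)) = redMat (((k').val : GL (Fin 3) (UnitaryGroup.LocalRing L v)).val.map (Pi.evalRingHom (fun w' : PlacesOver L v => w'.1.adicCompletion L) w)) := by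
    rw [hxk']
    exact congrArg redMat (coe_localNonsplitEquiv_apply L H' v w hw k')
  -- §4 the two residual unipotents and their finite-group conjugator (★ A-70 finite half)
  have hu : ((red xk : ↥(unitaryGroupOfForm σk (JO.map (IsLocalRing.residue 𝒪[(w.1.adicCompletion L)])))) : GL (Fin 3) 𝓀[(w.1.adicCompletion L)]) ∈ (unitaryGroupOfForm σk (JO.map (IsLocalRing.residue 𝒪[(w.1.adicCompletion L)]))) := (red xk).2
  have hu' : ((red xk' : ↥(unitaryGroupOfForm σk (JO.map (IsLocalRing.residue 𝒪[(w.1.adicCompletion L)])))) : GL (Fin 3) 𝓀[(w.1.adicCompletion L)]) ∈ (unitaryGroupOfForm σk (JO.map (IsLocalRing.residue 𝒪[(w.1.adicCompletion L)]))) := (red xk').2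
  have hnilk : IsNilpotent ((((red xk : ↥(unitaryGroupOfForm σk (JO.map (IsLocalRing.residue 𝒪[(w.1.adicCompletion L)])))) : GL (Fin 3) 𝓀[(w.1.adicCompletion L)]) : Matrix (Fin 3) (Fin 3) 𝓀[(w.1.adicCompletion L)]) - 1) := ⟨3, by rw [hredK, hMk]; exact hnil⟩
  have hnilk' : IsNilpotent ((((red xk' : ↥(unitaryGroupOfForm σk (JO.map (IsLocalRing.residue 𝒪[(w.1.adicCompletion L)])))) : GL (Fin 3) 𝓀[(w.1.adicCompletion L)]) : Matrix (Fin 3) (Fin 3) 𝓀[(w.1.adicCompletion L)]) - 1) := ⟨3, by rw [hredK, hMk']; exact hnil'⟩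
  have hrankk : ((((red xk : ↥(unitaryGroupOfForm σk (JO.map (IsLocalRing.residue 𝒪[(w.1.adicCompletion L)])))) : GL (Fin 3) 𝓀[(w.1.adicCompletion L)]) : Matrix (Fin 3) (Fin 3) 𝓀[(w.1.adicCompletion L)]) - 1).rank = ((((red xk' : ↥(unitaryGroupOfForm σk (JO.map (IsLocalRing.residue 𝒪[(w.1.adicCompletion L)])))) : GL (Fin 3) 𝓀[(w.1.adicCompletion L)]) : Matrix (Fin 3) (Fin 3) 𝓀[(w.1.adicCompletion L)]) - 1).rank := by
    rw [hredK, hredK, hMk, hMk']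
    exact hrank
  obtain ⟨yb, hyb, hconj⟩ := Literature.GroupTheory.SpecificGroups.exists_conj_eq_of_rank_sub_one_eq_of_hermitian_anyChar hq' σk hσq hJk hJkdet hu hu' hnilk hnilk' hrankk
  -- §5 lift the conjugator (Hensel surjectivity) and conjugate inside `K`
  obtain ⟨xy, hxy⟩ := hsurj ⟨yb, hyb⟩
  obtain ⟨y, hydef⟩ : ∃ y : ((cmDatum L 3 H').Local v), y = (localNonsplitEquiv (IsCMField.complexConj L) H' (IsCMField.complexConj_ne_one L) w hw).symm (xy : ↥(unitaryGroupOfForm (galAdicCompletionMap (L := L) (IsCMField.complexConj L) hw) (placeForm H' w.1))) := ⟨_, rfl⟩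
  have hey : (localNonsplitEquiv (IsCMField.complexConj L) H' (IsCMField.complexConj_ne_one L) w hw y) = (xy : ↥(unitaryGroupOfForm (galAdicCompletionMap (L := L) (IsCMField.complexConj L) hw) (placeForm H' w.1))) := by
    rw [hydef]
    exact (localNonsplitEquiv (IsCMField.complexConj L) H' (IsCMField.complexConj_ne_one L) w hw).apply_symm_apply _
  have hy : y ∈ (cmLocalIntegralLevel L 3 H' v) := by
    refine (mem_localIntegralLevel_iff_of_smul_eq (IsCMField.complexConj L) 3 H' hc1 w hw y).2 ?_
    rw [hey]
    exact xy.2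
  obtain ⟨u, hudef⟩ : ∃ u : ((cmDatum L 3 H').Local v), u = k' * (y * k * y⁻¹)⁻¹ := ⟨_, rfl⟩
  have hyky : y * k * y⁻¹ ∈ (cmLocalIntegralLevel L 3 H' v) := Subgroup.mul_mem _ (Subgroup.mul_mem _ hy hk) (Subgroup.inv_mem _ hy)
  have humem : u ∈ (cmLocalIntegralLevel L 3 H' v) := by
    rw [hudef]
    exact Subgroup.mul_mem _ hk' (Subgroup.inv_mem _ hyky)
  obtain ⟨xu, hxu0⟩ : ∃ z : ↥((glInt 3 (w.1.adicCompletion L)).subgroupOf (unitaryGroupOfForm (galAdicCompletionMap (L := L) (IsCMField.complexConj L) hw) (placeForm H' w.1))), (z : ↥(unitaryGroupOfForm (galAdicCompletionMap (L := L) (IsCMField.complexConj L) hw) (placeForm H' w.1))) = (localNonsplitEquiv (IsCMField.complexConj L) H' (IsCMField.complexConj_ne_one L) w hw u) := ⟨⟨(localNonsplitEquiv (IsCMField.complexConj L) H' (IsCMField.complexConj_ne_one L) w hw u), hKI humem⟩, rfl⟩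
  -- push `e` through the products (by `exact`: the carrier `(cmDatum L 3 H′).Local v` is the subgroup `«local»` definitionally)
  have he1 : (localNonsplitEquiv (IsCMField.complexConj L) H' (IsCMField.complexConj_ne_one L) w hw (y * k)) = (xy : ↥(unitaryGroupOfForm (galAdicCompletionMap (L := L) (IsCMField.complexConj L) hw) (placeForm H' w.1))) * (xk : ↥(unitaryGroupOfForm (galAdicCompletionMap (L := L) (IsCMField.complexConj L) hw) (placeForm H' w.1))) := by
    rw [← hey, hxk]; exact map_mul _ y k
  have he2 : (localNonsplitEquiv (IsCMField.complexConj L) H' (IsCMField.complexConj_ne_one L) w hw (y⁻¹)) = (xy : ↥(unitaryGroupOfForm (galAdicCompletionMap (L := L) (IsCMField.complexConj L) hw) (placeForm H' w.1)))⁻¹ := by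
    rw [← hey]; exact map_inv _ y
  have he3 : (localNonsplitEquiv (IsCMField.complexConj L) H' (IsCMField.complexConj_ne_one L) w hw (y * k * y⁻¹)) = (xy : ↥(unitaryGroupOfForm (galAdicCompletionMap (L := L) (IsCMField.complexConj L) hw) (placeForm H' w.1))) * (xk : ↥(unitaryGroupOfForm (galAdicCompletionMap (L := L) (IsCMField.complexConj L) hw) (placeForm H' w.1))) * (xy : ↥(unitaryGroupOfForm (galAdicCompletionMap (L := L) (IsCMField.complexConj L) hw) (placeForm H' w.1)))⁻¹ := by
    rw [← he1, ← he2]; exact map_mul _ (y * k) y⁻¹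
  have he4 : (localNonsplitEquiv (IsCMField.complexConj L) H' (IsCMField.complexConj_ne_one L) w hw ((y * k * y⁻¹)⁻¹)) = ((xy : ↥(unitaryGroupOfForm (galAdicCompletionMap (L := L) (IsCMField.complexConj L) hw) (placeForm H' w.1))) * (xk : ↥(unitaryGroupOfForm (galAdicCompletionMap (L := L) (IsCMField.complexConj L) hw) (placeForm H' w.1))) * (xy : ↥(unitaryGroupOfForm (galAdicCompletionMap (L := L) (IsCMField.complexConj L) hw) (placeForm H' w.1)))⁻¹)⁻¹ := by
    rw [← he3]; exact map_inv _ (y * k * y⁻¹)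
  have he5 : (localNonsplitEquiv (IsCMField.complexConj L) H' (IsCMField.complexConj_ne_one L) w hw (k' * (y * k * y⁻¹)⁻¹)) = (xk' : ↥(unitaryGroupOfForm (galAdicCompletionMap (L := L) (IsCMField.complexConj L) hw) (placeForm H' w.1))) * ((xy : ↥(unitaryGroupOfForm (galAdicCompletionMap (L := L) (IsCMField.complexConj L) hw) (placeForm H' w.1))) * (xk : ↥(unitaryGroupOfForm (galAdicCompletionMap (L := L) (IsCMField.complexConj L) hw) (placeForm H' w.1))) * (xy : ↥(unitaryGroupOfForm (galAdicCompletionMap (L := L) (IsCMField.complexConj L) hw) (placeForm H' w.1)))⁻¹)⁻¹ := by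
    rw [← he4, hxk']; exact map_mul _ k' (y * k * y⁻¹)⁻¹
  have hxu : xu = xk' * (xy * xk * xy⁻¹)⁻¹ := by
    apply Subtype.ext
    simp only [Subgroup.coe_mul, Subgroup.coe_inv]
    rw [hxu0, ← he5, hudef]
  -- `red(u_w) = 1`
  have hredu' : red xu = red xk' * (red xy * red xk * (red xy)⁻¹)⁻¹ := by
    rw [hxu]
    simp only [map_mul, map_inv]
  have hredu'' : red xu = red xk' * ((⟨yb, hyb⟩ : ↥(unitaryGroupOfForm σk (JO.map (IsLocalRing.residue 𝒪[(w.1.adicCompletion L)])))) * red xk * (⟨yb, hyb⟩ : ↥(unitaryGroupOfForm σk (JO.map (IsLocalRing.residue 𝒪[(w.1.adicCompletion L)]))))⁻¹)⁻¹ := by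
    simpa only [hxy] using hredu'
  have hredu : ((red xu : ↥(unitaryGroupOfForm σk (JO.map (IsLocalRing.residue 𝒪[(w.1.adicCompletion L)])))) : GL (Fin 3) 𝓀[(w.1.adicCompletion L)]) = 1 := by
    have hcoe := congrArg (fun z : ↥(unitaryGroupOfForm σk (JO.map (IsLocalRing.residue 𝒪[(w.1.adicCompletion L)]))) => (z : GL (Fin 3) 𝓀[(w.1.adicCompletion L)])) hredu''
    simp only [Subgroup.coe_mul, Subgroup.coe_inv, hconj, mul_inv_cancel] at hcoe
    exact hcoe
  have hredMat_u : redMat ((((localNonsplitEquiv (IsCMField.complexConj L) H' (IsCMField.complexConj_ne_one L) w hw u) : ↥(unitaryGroupOfForm (galAdicCompletionMap (L := L) (IsCMField.complexConj L) hw) (placeForm H' w.1))) : GL (Fin 3) (w.1.adicCompletion L)) : Matrix (Fin 3) (Fin 3) (w.1.adicCompletion L)) = 1 := by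
    rw [← hxu0, ← hredK xu, hredu, Units.val_one]
  -- §6 the ROW-0 bridge: `u_w ≡ 1 (ϖ)`, i.e. `hg1`'s hypothesis for `u`
  have hrank0 : (redMat ((((localNonsplitEquiv (IsCMField.complexConj L) H' (IsCMField.complexConj_ne_one L) w hw u) : ↥(unitaryGroupOfForm (galAdicCompletionMap (L := L) (IsCMField.complexConj L) hw) (placeForm H' w.1))) : GL (Fin 3) (w.1.adicCompletion L)) : Matrix (Fin 3) (Fin 3) (w.1.adicCompletion L)) - 1).rank = 0 := by
    rw [hredMat_u, sub_self, Matrix.rank_zero]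
  have hval := (rank_redMat_sub_one_eq_zero_iff_forall_valuation_le hϖ (hKI humem)).1 hrank0
  have hϖ0 : Valued.v (toPlace v w (HeckeCharacter.uniformizer ↥(maximalRealSubfield L) v : v.adicCompletion ↥(maximalRealSubfield L))) ≠ 0 := by
    rw [hϖv]; exact WithZero.coe_ne_zero
  have hg1u : ∀ x, g (u * x) = g x := by
    refine hg1 u fun a b => ?_
    have hab : Valued.v (((((localNonsplitEquiv (IsCMField.complexConj L) H' (IsCMField.complexConj_ne_one L) w hw u) : ↥(unitaryGroupOfForm (galAdicCompletionMap (L := L) (IsCMField.complexConj L) hw) (placeForm H' w.1))) : GL (Fin 3) (w.1.adicCompletion L)) : Matrix (Fin 3) (Fin 3) (w.1.adicCompletion L)) a b - (1 : Matrix (Fin 3) (Fin 3) (w.1.adicCompletion L)) a b) ≤ Valued.v (toPlace v w (HeckeCharacter.uniformizer ↥(maximalRealSubfield L) v : v.adicCompletion ↥(maximalRealSubfield L))) := by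
      rw [← Matrix.sub_apply]
      exact (v_le_iff_valuation_le _ _).2 (hval a b)
    rw [pow_one, Valuation.map_mul, Valuation.map_inv]
    have key := mul_le_mul_right hab (Valued.v (toPlace v w (HeckeCharacter.uniformizer ↥(maximalRealSubfield L) v : v.adicCompletion ↥(maximalRealSubfield L))))⁻¹
    rwa [inv_mul_cancel₀ hϖ0] at key
  -- §7 assemble: `g k = g (y k y⁻¹) = g (u · y k y⁻¹) = g k′`
  calc g k = g (y * k * y⁻¹) := (hginv y hy k).symm
    _ = g (u * (y * k * y⁻¹)) := (hg1u _).symm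
    _ = g k' := by rw [hudef]; exact congrArg g (inv_mul_cancel_right _ _)

set_option maxHeartbeats 800000 in
-- budget only: the statement carries the END stub's CM-place tokens; no search tactic runs long here.
/-- **ORGAN (U) «STRATA CONSTANCY OF A LEVEL-1 `K`-CLASS PIECE», EVERY RESIDUE CHARACTERISTIC** = ★ `strataConstancy_of_levelOne` with `h2` DELETED (dyadic `v ∣ 2`
included): a piece `g` on `U(H′)(L⁺_v)` that is `Ad K`-invariant (`K = U(H′)(𝒪_v)` hyperspecial at the non-split unramified `v`) and left-invariant
under the level-1 congruence set takes ONE value `c r` on each residually-unipotent Jordan stratum `rank(red k_w − 1) = r` of `K`.  `c r` is the common value of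
`apply_eq_apply_of_rank_redMat_sub_one_eq_anyChar` on the stratum (and `0` off the three strata). [cite: Rogawski1990, §4.9 p. 54; §3.9 p. 32, Prop. 3.9.1] -/
theorem strataConstancy_of_levelOne_anyChar
    (L : Type) [Field L] [NumberField L] [IsCMField L] (H' : Matrix (Fin 3) (Fin 3) L)
    {v : HeightOneSpectrum (𝓞 ↥(maximalRealSubfield L))}
    (hH' : (H'.map (cmConjRingHom L)).transpose = H') (w : PlacesOver L v)
    (hw : IsCMField.complexConj L • w.1 = w.1) (hv : Algebra.IsUnramifiedIn (𝓞 L) v.asIdeal)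
    (hH'w : IsUnit (placeForm H' w.1)) (hH'i : hH'w.unit ∈ glInt 3 (w.1.adicCompletion L))
    (g : ((cmDatum L 3 H').Local v) → ℂ)
    (hginv : ∀ u ∈ (cmLocalIntegralLevel L 3 H' v), ∀ x, g (u * x * u⁻¹) = g x)
    (hg1 : ∀ u : ((cmDatum L 3 H').Local v),
      (∀ a b, Valued.v ((((toPlace v w (HeckeCharacter.uniformizer ↥(maximalRealSubfield L) v : v.adicCompletion ↥(maximalRealSubfield L)))) ^ 1)⁻¹ *
        (((((localNonsplitEquiv (IsCMField.complexConj L) H' (IsCMField.complexConj_ne_one L) w hw u) : ↥(unitaryGroupOfForm (galAdicCompletionMap (L := L) (IsCMField.complexConj L) hw) (placeForm H' w.1))) : GL (Fin 3) (w.1.adicCompletion L)) : Matrix (Fin 3) (Fin 3) (w.1.adicCompletion L)) a b - (1 : Matrix (Fin 3) (Fin 3) (w.1.adicCompletion L)) a b)) ≤ 1) →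
      ∀ x, g (u * x) = g x) :
    ∃ c : ℕ → ℂ, ∀ k ∈ (cmLocalIntegralLevel L 3 H' v),
      (redMat (((k).val : GL (Fin 3) (UnitaryGroup.LocalRing L v)).val.map (Pi.evalRingHom (fun w' : PlacesOver L v => w'.1.adicCompletion L) w)) - 1) ^ 3 = 0 →
      g k = c (redMat (((k).val : GL (Fin 3) (UnitaryGroup.LocalRing L v)).val.map (Pi.evalRingHom (fun w' : PlacesOver L v => w'.1.adicCompletion L) w)) - 1).rank := by
  classical
  refine ⟨fun r => if h : ∃ k : ((cmDatum L 3 H').Local v), k ∈ (cmLocalIntegralLevel L 3 H' v) ∧ (redMat (((k).val : GL (Fin 3) (UnitaryGroup.LocalRing L v)).val.map (Pi.evalRingHom (fun w' : PlacesOver L v => w'.1.adicCompletion L) w)) - 1) ^ 3 = 0 ∧ (redMat (((k).val : GL (Fin 3) (UnitaryGroup.LocalRing L v)).val.map (Pi.evalRingHom (fun w' : PlacesOver L v => w'.1.adicCompletion L) w)) - 1).rank = r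
    then g h.choose else 0, fun k hk hnil => ?_⟩
  have hex : ∃ k₀ : ((cmDatum L 3 H').Local v), k₀ ∈ (cmLocalIntegralLevel L 3 H' v) ∧ (redMat (((k₀).val : GL (Fin 3) (UnitaryGroup.LocalRing L v)).val.map (Pi.evalRingHom (fun w' : PlacesOver L v => w'.1.adicCompletion L) w)) - 1) ^ 3 = 0 ∧
      (redMat (((k₀).val : GL (Fin 3) (UnitaryGroup.LocalRing L v)).val.map (Pi.evalRingHom (fun w' : PlacesOver L v => w'.1.adicCompletion L) w)) - 1).rank = (redMat (((k).val : GL (Fin 3) (UnitaryGroup.LocalRing L v)).val.map (Pi.evalRingHom (fun w' : PlacesOver L v => w'.1.adicCompletion L) w)) - 1).rank := ⟨k, hk, hnil, rfl⟩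
  dsimp only
  rw [dif_pos hex]
  exact apply_eq_apply_of_rank_redMat_sub_one_eq_anyChar L H' hH' w hw hv hH'w hH'i g hginv hg1 hk hex.choose_spec.1 hnil
    hex.choose_spec.2.1 hex.choose_spec.2.2.symm

end OrganU

end Literature.NumberTheory.Rogawski1990

end
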